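import Literature.Barriers.CriticalPhenomena.LongRangeTrivialityOnZ3InfraredBound
import Literature.Barriers.CriticalPhenomena.LongRangeTrivialityOnZ3NoSlidingScale

/-!
# Proposition 3.8's first display (kernel form) from Proposition 3.7: Fourier analysis on the
# Brillouin zone, the Fejér kernel, and the Messager–Miracle-Solé averaging

Sibling of `Literature/Barriers/CriticalPhenomena/LongRangeTrivialityOnZ3InfraredBound.lean` (barrier
catalogue D-0021, sub-problem `Ising3DConformalLimit`), second layer under the named fact
`panis_infraredBound_algebraic` (Panis 2023, arXiv:2309.05797 = Ann. Probab. 54 (2026), §3.6). The first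
layer reduced it to `panis_prop38_kernelForm` — Proposition 3.8's first display with the Gaussian weight
replaced by the product kernel `W(u) = ∏ᵢ(1 ∨ uᵢ²)⁻¹`. Here that display is PROVED from the two inputs
the printed proof of Proposition 3.8 names, vendored as facts, and from the Messager–Miracle-Solé
monotonicity (MMS2), which the tree proves (`panis_mms_two_point_monotone_holds`, `…MMSWalk`; its box average
`card_box_mul_pairCorrelation_le_boxSusceptibility` is taken from `…NoSlidingScale`):

* FACT `panis_prop37_infraredBound` — **Proposition 3.7**: for `β < β_c(ρ)` and `p ∈ (-π,π]^d`,
  `Ŝ_{ρ,β}(p) ≤ 1/(2β|J|(1 - Ĵ(p)))` (torus Gaussian domination Prop. 3.4 [FSS, FILS] passed to the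
  unique infinite-volume state below `β_c`, Fatou, Simon–Lieb), vendored for `J_{x,y} = C₀|x-y|₁^{-d-α}`,
  `0 < β < β_c`, `p ≠ 0`, with `Ŝ_β(p) = ∑_x S_β(x)cos(p·x)` (`LongRangeIsing.twoPointFourier`, the real
  form of the printed `∑_x e^{ip·x}S_β(x)`);
* FACT `abf_pairCorrelation_summable` — "`∑_{x∈ℤ^d} S_{ρ,β}(x) < ∞` for `β < β_c(ρ)` as proved in
  [ABF 1987]" (§3.3, the sentence making `Ŝ` well defined).

PROVED (namespace `Literature.Barriers.CriticalPhenomena.LongRangeIsing` unless stated):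

1. Trigonometric sums: Jordan `|t|/π ≤ |sin(t/2)|`; the geometric sum `G_n(t) = ∑_{j<n}e^{ijt}` with
   `‖G_n‖ ≤ n` and `‖G_n(t)‖ ≤ 1/|sin(t/2)|` (`(e^{it}-1)G_n = e^{int}-1`, `|e^{it}-1| = 2|sin(t/2)|`);
   the Dirichlet kernel `D_L(t) = ∑_{|y|≤L}e^{ity} = e^{-iLt}G_{2L+1}(t)` and its Fejér envelope
   `‖D_L(t)‖² ≤ 9π²L²(1 ∨ (Lt)²)⁻¹` (`|t| ≤ π`, `L ≥ 1`); the box character sum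
   `B_L(k) = ∑_{x∈Λ_L}e^{ik·x} = ∏ᵢD_L(kᵢ)` and `‖B_L(k)‖² ≤ (9π²)^d L^{2d} W(Lk)` on `‖k‖_∞ ≤ π`.
2. Fourier analysis on `[-π,π]^d` (product of interval measures): orthogonality
   `∫e^{-ik·w}dk = (2π)^d𝟙{w=0}`, the lattice Fourier transform `â(k) = ∑_x a(x)e^{-ik·x}` of
   `a ∈ ℓ¹(ℤ^d)` (bounded by `∑|a|`, continuous, `Re â(k) = ∑_x a(x)cos(k·x)`), Fourier inversion
   `∫e^{ik·y}â(k)dk = (2π)^d a(y)` (term-by-term integration), and the **Parseval identity for the Fejér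
   weight** `(2π)^d ∑_{x,y∈Λ_L} a(x-y) = ∫‖B_L(k)‖²â(k)dk = ∫‖B_L(k)‖² Re â(k)dk` (these mirror
   `integral_cexp_neg_kdot`, `latticeFT`, `integral_cexp_kdot_mul_latticeFT` of the percolation /
   lace-expansion files, re-proved here for the momentum conventions of the long-range Ising chain).
3. `sum_sum_pairCorrelation_le` — **Gaussian domination of the Fejér-weighted double sum**: for
   `0 < β < β_c`, `L ≥ 1`, `d ≥ 3`,
   `∑_{x,y∈Λ_L}S_β(x-y) ≤ (9π²)^d/(2(2π)^d) · L^d/(β|J|) · ∫_{(-πL,πL]^d} W(u)/(1-Ĵ(u/L)) du`: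
   Parseval, the pointwise bound `Ŝ_β ≤ 1/(2β|J|(1-Ĵ))` off the null hyperplane `k₀ = 0`
   (`integral_mono_ae`; the majorant is integrable because `1/(1-Ĵ(k)) ≤ ‖k‖^{-2}/c₁ ∈ L¹` for `d ≥ 3`,
   `integrableOn_inv_gap`), the Fejér envelope, and the substitution `u = Lk`
   (`Measure.setIntegral_comp_smul_of_pos`, `L•(-π,π]^d = (-πL,πL]^d`).
4. The averaging of the printed proof: `|Λ_m|χ_m ≤ ∑_{Λ_L×Λ_L}S(x-y)` (`2m ≤ L`), MMS2 averaged
   `|Λ_m|S(y) ≤ χ_m` (`|y|_∞ ≥ dm`, from `…NoSlidingScale`), and the counts `n^d ≤ |Λ_{⌊n/2⌋}|`, `(n/d)^d ≤ |Λ_{⌊n/d⌋}|`.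
5. **`panis_prop38_kernelForm_of_prop37 : panis_prop37_infraredBound → abf_pairCorrelation_summable →
   panis_mms_two_point_monotone → panis_prop38_kernelForm`** (for `x ≠ 0`, `n = |x|_∞`:
   `S(x) ≤ χ_{⌊n/d⌋}/|Λ_{⌊n/d⌋}| ≤ χ_{⌊n/2⌋}/|Λ_{⌊n/d⌋}| ≤ K_d d^d/(β|J|n^d)·∫_{(-πn,πn]^d}W/(1-Ĵ(u/n))`
   below `β_c`, and at `β_c` by the left-continuity `tendsto_pairCorrelation_nhdsLT` of `…LeftContinuity`),
   `panis_infraredBound_algebraic_of_prop37`, and — with the tree's MMS2 theorem —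
   **`panis_infraredBound_algebraic_of_prop37' : panis_prop37_infraredBound →
   abf_pairCorrelation_summable → panis_infraredBound_algebraic`**.

After this file the vendored infrared bound `panis_infraredBound_algebraic` rests on Proposition 3.7 and
the ABF finiteness of the susceptibility below `β_c` — the reflection-positivity / Gaussian-domination
theory of long-range tori and the sharpness of the long-range Ising transition, respectively.

## References

* R. Panis, arXiv:2309.05797 (2023) = Ann. Probab. 54 (2026): §3.3 (definition of `Ŝ_{ρ,β}`, the
  sentence citing [ABF]), Proposition 3.7 and its proof, Proposition 3.8 and its proof, Corollary 3.3
  (MMS2) [Panis2023Triviality] (held, TeX-derived text, chunks 13–15 read).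
* M. Aizenman, D. J. Barsky, R. Fernández, J. Stat. Phys. 47 (1987) 343–374
  [AizenmanBarskyFernandezJSP1987] (as cited by Panis; not consulted).
* J. Fröhlich, B. Simon, T. Spencer, CMP 50 (1976); J. Fröhlich, R. Israel, E. H. Lieb, B. Simon, CMP 62
  (1978) — behind Proposition 3.7 (not consulted).
* Mathlib: `geom_sum_eq`, `Complex.norm_exp_I_mul_ofReal_sub_one`, `Real.mul_le_sin`,
  `integral_exp_mul_complex`, `MeasureTheory.integral_fintype_prod_eq_prod`, `MeasureTheory.integral_tsum`,
  `integral_re`, `MeasureTheory.Measure.setIntegral_comp_smul_of_pos`, `Measure.univ_pi_Ioc_ae_eq_Icc`,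
  `Measure.ae_eval_ne`, `integrableOn_ball_of_norm_le_rpow`.
-/

noncomputable section


namespace Literature.Barriers.CriticalPhenomena

open Literature.Probability.LatticeModels Literature.Probability.Percolation Filter Topology Finset
open _root_.MeasureTheory _root_.Set Complex
open scoped symmDiff Real Pointwise

namespace LongRangeIsing

variable {d : ℕ}

/-! ### Jordan's inequality and geometric sums of unimodular exponentials -/

section Dirichlet

/-- Jordan's inequality: `|t|/π ≤ |sin(t/2)|` for `|t| ≤ π`. [folklore] -/
theorem abs_div_pi_le_abs_sin_half {t : ℝ} (ht : |t| ≤ Real.pi) : |t| / Real.pi ≤ |Real.sin (t / 2)| := by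
  have hπ := Real.pi_pos
  have hu0 : 0 ≤ |t| / 2 := by positivity
  have hu1 : |t| / 2 ≤ Real.pi / 2 := by linarith
  have h4 := Real.mul_le_sin hu0 hu1
  have h5 : Real.sin (|t| / 2) = |Real.sin (t / 2)| := by
    rcases abs_choice t with h | h
    · rw [h, abs_of_nonneg]
      rw [h] at hu1
      exact Real.sin_nonneg_of_nonneg_of_le_pi (by linarith [abs_nonneg t, h]) (by linarith)
    · rw [h, neg_div, Real.sin_neg, abs_of_nonpos]
      have : t / 2 ≤ 0 := by linarith [abs_nonneg t]
      exact Real.sin_nonpos_of_nonpos_of_neg_pi_le this (by linarith [abs_nonneg t])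
  rw [← h5]
  calc |t| / Real.pi = 2 / Real.pi * (|t| / 2) := by ring
    _ ≤ Real.sin (|t| / 2) := h4

/-- The geometric sum `G_n(t) = ∑_{j<n} e^{ijt}`. [folklore] -/
def geomExp (n : ℕ) (t : ℝ) : ℂ := ∑ j ∈ Finset.range n, Complex.exp (Complex.I * t) ^ j

/-- `‖e^{it}‖ = 1`. [folklore] -/
theorem norm_cexp_I_mul (t : ℝ) : ‖Complex.exp (Complex.I * t)‖ = 1 := by
  rw [mul_comm, Complex.norm_exp_ofReal_mul_I]

/-- `‖G_n(t)‖ ≤ n`. [folklore] -/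
theorem norm_geomExp_le (n : ℕ) (t : ℝ) : ‖geomExp n t‖ ≤ n := by
  unfold geomExp
  refine (norm_sum_le _ _).trans ?_
  have : ∀ j ∈ Finset.range n, ‖Complex.exp (Complex.I * t) ^ j‖ = 1 := fun j _ => by
    rw [norm_pow, norm_cexp_I_mul, one_pow]
  rw [Finset.sum_congr rfl this]
  simp

/-- `‖G_n(t)‖ ≤ 1/|sin(t/2)|` when `sin(t/2) ≠ 0` (`(e^{it}-1)G_n = e^{int} - 1`, `|e^{it}-1| = 2|sin(t/2)|`). [folklore] -/
theorem norm_geomExp_le_inv_abs_sin {t : ℝ} (h : Real.sin (t / 2) ≠ 0) (n : ℕ) :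
    ‖geomExp n t‖ ≤ 1 / |Real.sin (t / 2)| := by
  set z : ℂ := Complex.exp (Complex.I * t) with hz
  have hz1 : ‖z - 1‖ = 2 * |Real.sin (t / 2)| := by
    rw [hz, Complex.norm_exp_I_mul_ofReal_sub_one, Real.norm_eq_abs, abs_mul, abs_two]
  have hne : z ≠ 1 := by
    intro h1
    have : ‖z - 1‖ = 0 := by rw [h1, sub_self, norm_zero]
    rw [hz1] at this
    exact h (by linarith [abs_nonneg (Real.sin (t / 2)), abs_eq_zero.1 (by linarith : |Real.sin (t/2)| = 0)])
  have hzn : ‖z‖ = 1 := norm_cexp_I_mul t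
  unfold geomExp
  rw [← hz, geom_sum_eq hne n, norm_div, hz1]
  have hnum : ‖z ^ n - 1‖ ≤ 2 := by
    refine (norm_sub_le _ _).trans ?_
    rw [norm_pow, hzn, one_pow, norm_one]; norm_num
  have hs : 0 < |Real.sin (t / 2)| := abs_pos.2 h
  rw [div_le_div_iff₀ (by positivity) hs]
  nlinarith

/-- The one-dimensional Dirichlet kernel `D_L(t) = ∑_{y=-L}^{L} e^{ity}`. [folklore] -/
def dirichletKernel (L : ℕ) (t : ℝ) : ℂ :=
  ∑ y ∈ Finset.Icc (-(L : ℤ)) L, Complex.exp (Complex.I * ((t * y : ℝ) : ℂ))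

/-- `D_L(t) = e^{-iLt} G_{2L+1}(t)`. [folklore] -/
theorem dirichletKernel_eq (L : ℕ) (t : ℝ) :
    dirichletKernel L t = Complex.exp (-(Complex.I * ((t * L : ℝ) : ℂ))) * geomExp (2 * L + 1) t := by
  unfold dirichletKernel geomExp
  have himage : Finset.Icc (-(L : ℤ)) L = (Finset.range (2 * L + 1)).image fun j : ℕ => (j : ℤ) - L := by
    ext y
    simp only [Finset.mem_Icc, Finset.mem_image, Finset.mem_range]
    constructor
    · rintro ⟨h1, h2⟩
      refine ⟨(y + L).toNat, ?_, ?_⟩ <;> omega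
    · rintro ⟨j, hj, rfl⟩; omega
  rw [himage, Finset.sum_image (fun j _ j' _ h => by simpa using h), Finset.mul_sum]
  refine Finset.sum_congr rfl fun j _ => ?_
  rw [← Complex.exp_nat_mul, ← Complex.exp_add]
  congr 1
  push_cast
  ring

/-- `‖D_L(t)‖ = ‖G_{2L+1}(t)‖`. [folklore] -/
theorem norm_dirichletKernel (L : ℕ) (t : ℝ) : ‖dirichletKernel L t‖ = ‖geomExp (2 * L + 1) t‖ := by
  rw [dirichletKernel_eq, norm_mul, Complex.norm_exp]
  simp

/-- **The Fejér envelope of the Dirichlet kernel**: `‖D_L(t)‖² ≤ 9π² L² (1 ∨ (Lt)²)⁻¹` for `L ≥ 1`,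
`|t| ≤ π` (from `‖D_L‖ ≤ 2L+1` and `‖D_L(t)‖ ≤ 1/|sin(t/2)| ≤ π/|t|`). [folklore] -/
theorem norm_dirichletKernel_sq_le {L : ℕ} (hL : 1 ≤ L) {t : ℝ} (ht : |t| ≤ Real.pi) :
    ‖dirichletKernel L t‖ ^ 2 ≤ 9 * Real.pi ^ 2 * (L : ℝ) ^ 2 * (max 1 ((L * t) ^ 2))⁻¹ := by
  have hπ := Real.pi_pos
  have hπ1 : (1 : ℝ) ≤ Real.pi := by linarith [Real.two_le_pi]
  have hL1 : (1 : ℝ) ≤ L := by exact_mod_cast hL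
  rw [norm_dirichletKernel]
  rcases le_total ((L * t) ^ 2) 1 with hsmall | hbig
  · rw [max_eq_left hsmall, inv_one, mul_one]
    have h1 := norm_geomExp_le (2 * L + 1) t
    have h2 : ((2 * L + 1 : ℕ) : ℝ) ≤ 3 * L := by push_cast; linarith
    calc ‖geomExp (2 * L + 1) t‖ ^ 2 ≤ (3 * L) ^ 2 := by
          exact pow_le_pow_left₀ (norm_nonneg _) (h1.trans h2) 2
      _ = 9 * 1 * (L : ℝ) ^ 2 := by ring
      _ ≤ 9 * Real.pi ^ 2 * (L : ℝ) ^ 2 := by gcongr; nlinarith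
  · rw [max_eq_right hbig]
    have ht0 : t ≠ 0 := by
      intro h0; rw [h0, mul_zero, zero_pow two_ne_zero] at hbig; linarith
    have hsin : Real.sin (t / 2) ≠ 0 := by
      intro h0
      have := abs_div_pi_le_abs_sin_half ht
      rw [h0, abs_zero] at this
      have : |t| / Real.pi ≤ 0 := this
      have : 0 < |t| / Real.pi := div_pos (abs_pos.2 ht0) hπ
      linarith
    have h1 := norm_geomExp_le_inv_abs_sin hsin (2 * L + 1)
    have h2 : 1 / |Real.sin (t / 2)| ≤ Real.pi / |t| := by
      rw [div_le_div_iff₀ (abs_pos.2 hsin) (abs_pos.2 ht0), one_mul]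
      have := abs_div_pi_le_abs_sin_half ht
      rw [div_le_iff₀ hπ] at this
      linarith
    have h3 : ‖geomExp (2 * L + 1) t‖ ≤ Real.pi / |t| := h1.trans h2
    have ht2 : 0 < t ^ 2 := by positivity
    calc ‖geomExp (2 * L + 1) t‖ ^ 2 ≤ (Real.pi / |t|) ^ 2 := pow_le_pow_left₀ (norm_nonneg _) h3 2
      _ = Real.pi ^ 2 * (L : ℝ) ^ 2 * ((L * t) ^ 2)⁻¹ := by
          rw [div_pow, sq_abs]; field_simp
      _ ≤ 9 * Real.pi ^ 2 * (L : ℝ) ^ 2 * ((L * t) ^ 2)⁻¹ := by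
          have : 0 ≤ Real.pi ^ 2 * (L : ℝ) ^ 2 * ((L * t) ^ 2)⁻¹ := by positivity
          nlinarith

/-- The character sum of a box factorises: `∑_{a∈Λ_L} e^{ik·a} = ∏ᵢ D_L(kᵢ)`. [folklore] -/
theorem sum_box_cexp_phase (L : ℕ) (k : Fin d → ℝ) :
    ∑ a ∈ box d L, Complex.exp (Complex.I * (phase k a : ℂ)) = ∏ i, dirichletKernel L (k i) := by
  unfold dirichletKernel
  rw [box, Finset.prod_univ_sum]
  refine Finset.sum_congr rfl fun a _ => ?_
  rw [← Complex.exp_sum]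
  congr 1
  rw [phase]
  push_cast
  rw [Finset.mul_sum]

/-- **The Fejér envelope of the box character sum**: `‖∑_{a∈Λ_L}e^{ik·a}‖² ≤ (9π²)^d L^{2d} W(Lk)` on the
cube `‖k‖_∞ ≤ π` (`L ≥ 1`). [folklore] -/
theorem norm_sum_box_cexp_sq_le {L : ℕ} (hL : 1 ≤ L) {k : Fin d → ℝ} (hk : ‖k‖ ≤ Real.pi) :
    ‖∑ a ∈ box d L, Complex.exp (Complex.I * (phase k a : ℂ))‖ ^ 2 ≤
      (9 * Real.pi ^ 2) ^ d * (L : ℝ) ^ (2 * d) * envelope d ((L : ℝ) • k) := by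
  rw [sum_box_cexp_phase, norm_prod, ← Finset.prod_pow, envelope]
  have hki : ∀ i, |k i| ≤ Real.pi := fun i => (norm_le_pi_norm k i).trans hk
  calc ∏ i, ‖dirichletKernel L (k i)‖ ^ 2
      ≤ ∏ i : Fin d, 9 * Real.pi ^ 2 * (L : ℝ) ^ 2 * (max 1 ((L * k i) ^ 2))⁻¹ :=
        Finset.prod_le_prod (fun i _ => by positivity) fun i _ => norm_dirichletKernel_sq_le hL (hki i)
    _ = (9 * Real.pi ^ 2) ^ d * (L : ℝ) ^ (2 * d) * ∏ i : Fin d, (max 1 ((((L : ℝ) • k) i) ^ 2))⁻¹ := by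
        rw [Finset.prod_mul_distrib, Finset.prod_const, Finset.card_univ, Fintype.card_fin, mul_pow,
          ← pow_mul]
        simp only [Pi.smul_apply, smul_eq_mul]

end Dirichlet

/-! ### Fourier analysis on the cube `[-π,π]^d`: orthogonality, inversion for `ℓ¹(ℤ^d)`, and the
Parseval identity for the Fejér weight -/

section CubeFourier

/-- Lebesgue measure on `[-π,π]`. [folklore] -/
def circleMeasure : Measure ℝ := volume.restrict (Set.Icc (-Real.pi) Real.pi)

/-- `[-π,π]` has finite Lebesgue measure. [folklore] -/
instance : IsFiniteMeasure circleMeasure := by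
  rw [circleMeasure]
  exact isFiniteMeasure_restrict.2 (by rw [Real.volume_Icc]; exact ENNReal.ofReal_ne_top)

/-- Lebesgue measure on the closed cube `[-π,π]^d`, as a product measure. [folklore] -/
def cubeMeasure (d : ℕ) : Measure (Fin d → ℝ) := Measure.pi fun _ : Fin d => circleMeasure

/-- The cube measure is finite. [folklore] -/
instance : IsFiniteMeasure (cubeMeasure d) := by
  unfold cubeMeasure; infer_instance

/-- The closed Brillouin zone `[-π,π]^d`. [cite: Panis2023Triviality, Proposition 3.7 (p ∈ (-π,π]^d)] -/
def momentumCube (d : ℕ) : Set (Fin d → ℝ) := Set.pi Set.univ fun _ : Fin d => Set.Icc (-Real.pi) Real.pi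

/-- The closed cube is measurable. [folklore] -/
theorem measurableSet_momentumCube : MeasurableSet (momentumCube d) :=
  MeasurableSet.univ_pi fun _ => measurableSet_Icc

/-- Lebesgue measure restricted to the cube is the product of the interval measures. [folklore] -/
theorem volume_restrict_momentumCube :
    (volume : Measure (Fin d → ℝ)).restrict (momentumCube d) = cubeMeasure d := by
  rw [momentumCube, cubeMeasure, MeasureTheory.volume_pi, Measure.restrict_pi_pi]
  rfl

/-- `∫_{-π}^{π} e^{-i n t} dt = 2π 𝟙{n = 0}` for an integer `n` (as in
`Literature.Probability.Percolation.integral_cexp_neg_int_mul`). [folklore] -/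
theorem integral_cexp_neg_int_mul (n : ℤ) :
    ∫ t, Complex.exp (-(Complex.I * ((n : ℝ) * t : ℝ))) ∂circleMeasure =
      if n = 0 then (2 * Real.pi : ℂ) else 0 := by
  unfold circleMeasure
  rw [integral_Icc_eq_integral_Ioc, ← intervalIntegral.integral_of_le (by linarith [Real.pi_pos])]
  split_ifs with hn
  · subst hn
    simp; ring
  · have hc : (-(Complex.I * (n : ℂ))) ≠ 0 := by
      simp [Complex.I_ne_zero, hn]
    have key : ∀ t : ℝ, Complex.exp (-(Complex.I * ((n : ℝ) * t : ℝ))) =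
        Complex.exp (-(Complex.I * (n : ℂ)) * t) := by
      intro t; congr 1; push_cast; ring
    simp_rw [key]
    rw [integral_exp_mul_complex hc]
    have hper : Complex.exp (-(Complex.I * (n : ℂ)) * (Real.pi : ℝ)) =
        Complex.exp (-(Complex.I * (n : ℂ)) * (-Real.pi : ℝ)) := by
      rw [← mul_inv_eq_one₀ (Complex.exp_ne_zero _), ← Complex.exp_neg, ← Complex.exp_add]
      have : -(Complex.I * (n : ℂ)) * ((Real.pi : ℝ) : ℂ) + -(-(Complex.I * (n : ℂ)) * ((-Real.pi : ℝ) : ℂ)) =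
          ((-n : ℤ) : ℂ) * (2 * Real.pi * Complex.I) := by push_cast; ring
      rw [this, Complex.exp_int_mul_two_pi_mul_I]
    rw [hper, sub_self, zero_div]

/-- **Orthogonality of the characters on the cube**: `∫_{[-π,π]^d} e^{-i k·w} dk = (2π)^d 𝟙{w = 0}` for
`w ∈ ℤ^d` (as in `Literature.Probability.Percolation.integral_cexp_neg_kdot`). [folklore] -/
theorem integral_cexp_neg_phase (w : Site d) :
    ∫ k, Complex.exp (-(Complex.I * (phase k w : ℝ))) ∂cubeMeasure d =
      if w = 0 then ((2 * Real.pi) ^ d : ℂ) else 0 := by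
  set f : Fin d → ℝ → ℂ := fun j t => Complex.exp (-(Complex.I * (((w j : ℝ) * t : ℝ) : ℂ))) with hf
  have key : ∀ k : Fin d → ℝ, Complex.exp (-(Complex.I * (phase k w : ℝ))) = ∏ j, f j (k j) := by
    intro k
    rw [← Complex.exp_sum]
    congr 1
    simp only [phase, Complex.ofReal_sum, Finset.mul_sum, ← Finset.sum_neg_distrib]
    refine Finset.sum_congr rfl fun j _ => ?_
    push_cast; ring
  simp_rw [key]
  have hprod := integral_fintype_prod_eq_prod (𝕜 := ℂ) f (μ := fun _ : Fin d => circleMeasure)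
  rw [show cubeMeasure d = Measure.pi (fun _ : Fin d => circleMeasure) from rfl, hprod]
  have hj : ∀ j, ∫ t, f j t ∂circleMeasure = if w j = 0 then (2 * Real.pi : ℂ) else 0 := fun j =>
    integral_cexp_neg_int_mul (w j)
  simp_rw [hj]
  split_ifs with hw
  · subst hw
    simp
  · obtain ⟨j, hj⟩ : ∃ j, w j ≠ 0 := by
      by_contra h
      push Not at h
      exact hw (funext h)
    exact Finset.prod_eq_zero (Finset.mem_univ j) (if_neg hj)

/-- The lattice Fourier transform `â(k) = ∑_{x∈ℤ^d} a(x) e^{-ik·x}` of a summable function on `ℤ^d`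
(same expression as `Literature.Barriers.CriticalPhenomena.latticeFT` of the lace-expansion files).
[cite: Panis2023Triviality, §3.3 (Ŝ_{ρ,β}(p) := ∑_x e^{ip·x}S_{ρ,β}(x))] -/
def siteFT (a : Site d → ℝ) (k : Fin d → ℝ) : ℂ :=
  ∑' x : Site d, (a x : ℂ) * Complex.exp (-(Complex.I * (phase k x : ℂ)))

/-- `‖a(x)e^{-ik·x}‖ = |a(x)|`. [folklore] -/
private theorem norm_siteFT_term (a : Site d → ℝ) (k : Fin d → ℝ) (x : Site d) :
    ‖(a x : ℂ) * Complex.exp (-(Complex.I * (phase k x : ℂ)))‖ = |a x| := by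
  rw [norm_mul, Complex.norm_real, Real.norm_eq_abs, Complex.norm_exp]
  simp

/-- `‖â(k)‖ ≤ ∑|a|`. [folklore] -/
theorem norm_siteFT_le {a : Site d → ℝ} (ha : Summable fun x => |a x|) (k : Fin d → ℝ) :
    ‖siteFT a k‖ ≤ ∑' x, |a x| := by
  unfold siteFT
  refine (norm_tsum_le_tsum_norm ?_).trans (le_of_eq (tsum_congr fun x => norm_siteFT_term a k x))
  simpa only [norm_siteFT_term] using ha

/-- `â` is continuous (uniformly convergent series). [folklore] -/
theorem continuous_siteFT {a : Site d → ℝ} (ha : Summable fun x => |a x|) : Continuous (siteFT a) := by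
  unfold siteFT
  refine continuous_tsum (fun x => ?_) ha fun x k => (norm_siteFT_term a k x).le
  exact continuous_const.mul (Complex.continuous_exp.comp
    ((Complex.continuous_ofReal.comp (continuous_phase x)).const_mul _).neg)

/-- The real part of `â(k)` is `∑_x a(x)cos(k·x)`. [folklore] -/
theorem re_siteFT {a : Site d → ℝ} (ha : Summable fun x => |a x|) (k : Fin d → ℝ) :
    (siteFT a k).re = ∑' x, a x * Real.cos (phase k x) := by
  unfold siteFT
  have hs : Summable fun x : Site d => (a x : ℂ) * Complex.exp (-(Complex.I * (phase k x : ℂ))) :=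
    Summable.of_norm (by simpa only [norm_siteFT_term] using ha)
  rw [Complex.re_tsum hs]
  refine tsum_congr fun x => ?_
  rw [show -(Complex.I * (phase k x : ℂ)) = ((-phase k x : ℝ) : ℂ) * Complex.I by push_cast; ring,
    Complex.re_ofReal_mul, Complex.exp_ofReal_mul_I_re, Real.cos_neg]

/-- **Fourier inversion for `ℓ¹(ℤ^d)`**: `∫_{[-π,π]^d} e^{ik·y} â(k) dk = (2π)^d a(y)` for absolutely
summable `a` (term-by-term integration and orthogonality; as in
`Literature.Barriers.CriticalPhenomena.integral_cexp_kdot_mul_latticeFT`). [folklore] -/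
theorem integral_cexp_phase_mul_siteFT {a : Site d → ℝ} (ha : Summable fun x => |a x|) (y : Site d) :
    ∫ k, Complex.exp (Complex.I * (phase k y : ℂ)) * siteFT a k ∂cubeMeasure d =
      ((2 * Real.pi) ^ d : ℂ) * (a y : ℂ) := by
  classical
  set F : Site d → (Fin d → ℝ) → ℂ := fun x k =>
    (a x : ℂ) * Complex.exp (-(Complex.I * (phase k (x - y) : ℂ))) with hF
  have hsub : ∀ (k : Fin d → ℝ) (x : Site d), phase k (x - y) = phase k x - phase k y := fun k x => by
    rw [sub_eq_add_neg, phase_add]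
    simp [phase, Finset.sum_neg_distrib, mul_neg, sub_eq_add_neg]
  have hexp : ∀ k, Complex.exp (Complex.I * (phase k y : ℂ)) * siteFT a k = ∑' x, F x k := by
    intro k
    unfold siteFT
    rw [← tsum_mul_left]
    refine tsum_congr fun x => ?_
    simp only [hF, hsub]
    rw [mul_left_comm, ← Complex.exp_add]
    congr 2
    push_cast
    ring
  simp_rw [hexp]
  have hFm : ∀ x, AEStronglyMeasurable (F x) (cubeMeasure d) := by
    intro x
    refine Continuous.aestronglyMeasurable ?_
    exact continuous_const.mul (Complex.continuous_exp.comp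
      ((Complex.continuous_ofReal.comp (continuous_phase (x - y))).const_mul _).neg)
  have hFnorm : ∀ x k, ‖F x k‖ₑ = ‖a x‖ₑ := by
    intro x k
    rw [← ofReal_norm, ← ofReal_norm, hF]
    dsimp only
    rw [norm_mul, Complex.norm_real, Complex.norm_exp, Real.norm_eq_abs]
    simp
  have hsum : ∑' x, ∫⁻ k, ‖F x k‖ₑ ∂cubeMeasure d ≠ ⊤ := by
    simp_rw [hFnorm, lintegral_const]
    rw [ENNReal.tsum_mul_right]
    refine ENNReal.mul_ne_top ?_ (measure_ne_top _ _)
    have : ∑' x, ‖a x‖ₑ = ENNReal.ofReal (∑' x, |a x|) := by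
      rw [ENNReal.ofReal_tsum_of_nonneg (fun _ => abs_nonneg _) ha]
      refine tsum_congr fun x => ?_
      rw [← ofReal_norm, Real.norm_eq_abs]
    rw [this]
    exact ENNReal.ofReal_ne_top
  rw [integral_tsum hFm hsum]
  have hterm : ∀ x, ∫ k, F x k ∂cubeMeasure d =
      (a x : ℂ) * (if x - y = 0 then ((2 * Real.pi) ^ d : ℂ) else 0) := by
    intro x
    simp only [hF]
    rw [integral_const_mul]
    congr 1
    have := integral_cexp_neg_phase (d := d) (x - y)
    convert this using 3
  simp_rw [hterm]
  rw [tsum_eq_single y]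
  · rw [sub_self, if_pos rfl, mul_comm]
  · intro x hx
    rw [if_neg (sub_ne_zero.2 hx), mul_zero]

/-- The box character sum `B_L(k) = ∑_{x∈Λ_L} e^{ik·x}`. [folklore] -/
def boxCharSum (d L : ℕ) (k : Fin d → ℝ) : ℂ := ∑ x ∈ box d L, Complex.exp (Complex.I * (phase k x : ℂ))

/-- `‖B_L(k)‖² = ∑_{x,y∈Λ_L} e^{ik·(x-y)}` (the Fejér weight is a positive-definite double sum). [folklore] -/
theorem normSq_boxCharSum (L : ℕ) (k : Fin d → ℝ) :
    ((‖boxCharSum d L k‖ ^ 2 : ℝ) : ℂ) =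
      ∑ x ∈ box d L, ∑ y ∈ box d L, Complex.exp (Complex.I * (phase k (x - y) : ℂ)) := by
  rw [← Complex.normSq_eq_norm_sq, ← Complex.mul_conj, boxCharSum, map_sum, Finset.sum_mul_sum]
  refine Finset.sum_congr rfl fun x _ => Finset.sum_congr rfl fun y _ => ?_
  rw [← Complex.exp_conj, ← Complex.exp_add]
  congr 1
  have hsub : phase k (x - y) = phase k x - phase k y := by
    rw [sub_eq_add_neg, phase_add]
    simp [phase, Finset.sum_neg_distrib, mul_neg, sub_eq_add_neg]
  rw [hsub, map_mul, Complex.conj_I, Complex.conj_ofReal]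
  push_cast
  ring

/-- `‖B_L(k)‖ ≤ |Λ_L|`. [folklore] -/
theorem norm_boxCharSum_le (L : ℕ) (k : Fin d → ℝ) : ‖boxCharSum d L k‖ ≤ #(box d L) := by
  unfold boxCharSum
  refine (norm_sum_le _ _).trans ?_
  have : ∀ x ∈ box d L, ‖Complex.exp (Complex.I * (phase k x : ℂ))‖ = 1 := fun x _ => by
    rw [Complex.norm_exp]; simp
  rw [Finset.sum_congr rfl this]
  simp

/-- `B_L` is continuous. [folklore] -/
theorem continuous_boxCharSum (L : ℕ) : Continuous (boxCharSum d L) :=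
  continuous_finsetSum _ fun x _ => Complex.continuous_exp.comp
    ((Complex.continuous_ofReal.comp (continuous_phase x)).const_mul _)

/-- **Parseval for the Fejér weight**: for `a ∈ ℓ¹(ℤ^d)`,
`(2π)^d ∑_{x,y∈Λ_L} a(x-y) = ∫_{[-π,π]^d} ‖B_L(k)‖² â(k) dk`. [folklore] -/
theorem sum_sum_eq_integral_normSq_mul_siteFT {a : Site d → ℝ} (ha : Summable fun x => |a x|) (L : ℕ) :
    ((2 * Real.pi) ^ d : ℂ) * ∑ x ∈ box d L, ∑ y ∈ box d L, (a (x - y) : ℂ) =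
      ∫ k, ((‖boxCharSum d L k‖ ^ 2 : ℝ) : ℂ) * siteFT a k ∂cubeMeasure d := by
  simp_rw [normSq_boxCharSum, Finset.sum_mul]
  have hint : ∀ z : Site d, Integrable (fun k => Complex.exp (Complex.I * (phase k z : ℂ)) * siteFT a k)
      (cubeMeasure d) := by
    intro z
    refine Integrable.mono' (integrable_const (∑' x, |a x|)) ?_ (ae_of_all _ fun k => ?_)
    · exact ((Complex.continuous_exp.comp ((Complex.continuous_ofReal.comp (continuous_phase z)).const_mul
        _)).mul (continuous_siteFT ha)).aestronglyMeasurable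
    · rw [norm_mul, Complex.norm_exp]
      simp only [Complex.mul_re, Complex.I_re, Complex.ofReal_re, zero_mul, Complex.I_im, Complex.ofReal_im,
        mul_zero, sub_zero, Real.exp_zero, one_mul]
      exact norm_siteFT_le ha k
  rw [integral_finsetSum _ fun x _ => integrable_finsetSum _ fun y _ => hint (x - y)]
  rw [Finset.mul_sum]
  refine Finset.sum_congr rfl fun x _ => ?_
  rw [integral_finsetSum _ fun y _ => hint (x - y), Finset.mul_sum]
  refine Finset.sum_congr rfl fun y _ => ?_
  rw [integral_cexp_phase_mul_siteFT ha (x - y)]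

/-- **Parseval for the Fejér weight, real form**: `(2π)^d ∑_{x,y∈Λ_L} a(x-y) = ∫ ‖B_L(k)‖² Re â(k) dk`. [folklore] -/
theorem sum_sum_eq_integral_normSq_mul_re_siteFT {a : Site d → ℝ} (ha : Summable fun x => |a x|) (L : ℕ) :
    (2 * Real.pi) ^ d * ∑ x ∈ box d L, ∑ y ∈ box d L, a (x - y) =
      ∫ k, ‖boxCharSum d L k‖ ^ 2 * (siteFT a k).re ∂cubeMeasure d := by
  have h := sum_sum_eq_integral_normSq_mul_siteFT ha L
  have hint : Integrable (fun k => ((‖boxCharSum d L k‖ ^ 2 : ℝ) : ℂ) * siteFT a k) (cubeMeasure d) := by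
    refine Integrable.mono' (integrable_const ((#(box d L) : ℝ) ^ 2 * ∑' x, |a x|)) ?_ (ae_of_all _ fun k => ?_)
    · exact ((Complex.continuous_ofReal.comp ((continuous_boxCharSum L).norm.pow 2)).mul
        (continuous_siteFT ha)).aestronglyMeasurable
    · rw [norm_mul, Complex.norm_real, Real.norm_eq_abs, abs_of_nonneg (sq_nonneg _)]
      exact mul_le_mul (pow_le_pow_left₀ (norm_nonneg _) (norm_boxCharSum_le L k) 2)
        (norm_siteFT_le ha k) (norm_nonneg _) (sq_nonneg _)
  have h2 := congr_arg Complex.re h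
  have h3 : (∫ k, ((‖boxCharSum d L k‖ ^ 2 : ℝ) : ℂ) * siteFT a k ∂cubeMeasure d).re =
      ∫ k, (((‖boxCharSum d L k‖ ^ 2 : ℝ) : ℂ) * siteFT a k).re ∂cubeMeasure d := by
    have := integral_re hint
    simpa using this.symm
  rw [h3] at h2
  simp only [Complex.re_ofReal_mul] at h2
  rw [← h2]
  have h4 : ((2 * Real.pi) ^ d : ℂ) * ∑ x ∈ box d L, ∑ y ∈ box d L, (a (x - y) : ℂ) =
      (((2 * Real.pi) ^ d * ∑ x ∈ box d L, ∑ y ∈ box d L, a (x - y) : ℝ) : ℂ) := by push_cast; rfl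
  rw [h4, Complex.ofReal_re]

end CubeFourier

/-! ### The Fourier transform of the two-point function -/

section TwoPointFT

/-- **`Ŝ_β(p) := ∑_{x∈ℤ^d} e^{ip·x} S_β(x)`** in real form `∑_x S_β(x)cos(p·x)` (the printed sum is real
because `S_β(-x) = S_β(x)`; it converges absolutely when `∑_x S_β(x) < ∞`, i.e. below `β_c`).
[cite: Panis2023Triviality, §3.3 (display defining Ŝ_{ρ,β}(p), "well defined since ∑S < ∞ for β < β_c(ρ)")] -/
def twoPointFourier (J : Site d → Site d → ℝ) (β : ℝ) (p : Fin d → ℝ) : ℝ :=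
  ∑' x : Site d, pairCorrelation J β 0 x * Real.cos (phase p x)

/-- `Ŝ_β = Re(FT S_β)` for a summable two-point function. [folklore] -/
theorem re_siteFT_pairCorrelation {J : Site d → Site d → ℝ} {β : ℝ} (hβ : 0 ≤ β) (hJ : ∀ x y, 0 ≤ J x y)
    (hs : Summable fun x : Site d => pairCorrelation J β 0 x) (p : Fin d → ℝ) :
    (siteFT (fun x => pairCorrelation J β 0 x) p).re = twoPointFourier J β p := by
  rw [re_siteFT]
  · rfl
  · simpa only [abs_of_nonneg (pairCorrelation_nonneg J β hβ hJ 0 _)] using hs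

end TwoPointFT

end LongRangeIsing

open LongRangeIsing

/-! ### The named facts of the next layer: Proposition 3.7 and the summability below `β_c` -/

/-- NAMED FACT — **Panis 2023, Proposition 3.7 (the infrared bound in infinite volume, below `β_c`),
for `J_{x,y} = C₀|x-y|₁^{-d-α}`.** "Let `β < β_c(ρ)`. Let `p ∈ (-π,π]^d`. Then
`Ŝ_{ρ,β}(p) ≤ 1/(2β|J|(1 - Ĵ(p)))`" (from the torus Gaussian domination Proposition 3.4
[Fröhlich–Simon–Spencer, Fröhlich–Israel–Lieb–Simon], the uniqueness of the infinite-volume state and the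
convergence of the torus two-point function below `β_c`, Fatou's lemma, and the Simon–Lieb inequality
with `χ(β) < ∞`). Vendored for the algebraically decaying family (`d ≥ 1`), `0 < β < β_c`, with `Ŝ_β`
in the real form `twoPointFourier` of the free-boundary state (the unique state below `β_c`), `Ĵ` the
real form `couplingFourier`, and `p ≠ 0` (at `p = 0` the printed right-hand side is `+∞`; in Lean
`1/0 = 0`). Users take `(h : panis_prop37_infraredBound)`. [cite: Panis2023Triviality, Proposition 3.7] -/
def panis_prop37_infraredBound : Prop :=
  ∀ (d : ℕ), 1 ≤ d → ∀ (C₀ α : ℝ), 0 < C₀ → 0 < α →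
    ∀ (β : ℝ), 0 < β → β < LongRangeIsing.criticalBeta (algebraicCoupling d C₀ α) →
      ∀ p ∈ momentumBox d 1, p ≠ 0 →
        twoPointFourier (algebraicCoupling d C₀ α) β p ≤
          1 / (2 * β * couplingNorm (algebraicCoupling d C₀ α) *
            (1 - couplingFourier (algebraicCoupling d C₀ α) p))

/-- NAMED FACT — **finite susceptibility below `β_c` (Aizenman–Barsky–Fernández 1987), as used by
Panis 2023, §3.3**: "this quantity [`Ŝ_{ρ,β}`] is well defined since `∑_{x∈ℤ^d} S_{ρ,β}(x) < ∞` for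
`β < β_c(ρ)` as proved in [ABF]". Vendored for `J_{x,y} = C₀|x-y|₁^{-d-α}` (`d ≥ 1`), `0 < β < β_c`, as
the summability of `x ↦ ⟨σ₀σ_x⟩_β` (free-boundary state). Users take
`(h : abf_pairCorrelation_summable)`. [cite: Panis2023Triviality, §3.3 (sentence after the definition of Ŝ_{ρ,β})] [cite: AizenmanBarskyFernandezJSP1987, Theorem (finiteness of χ below β_c)] -/
def abf_pairCorrelation_summable : Prop :=
  ∀ (d : ℕ), 1 ≤ d → ∀ (C₀ α : ℝ), 0 < C₀ → 0 < α →
    ∀ (β : ℝ), 0 < β → β < LongRangeIsing.criticalBeta (algebraicCoupling d C₀ α) →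
      Summable fun x : Site d => pairCorrelation (algebraicCoupling d C₀ α) β 0 x

namespace LongRangeIsing

variable {d : ℕ}

/-! ### Gaussian domination of the Fejér-weighted double sum below `β_c` -/

section DoubleSum

/-- `L • (-π,π]^d = (-πL,πL]^d`. [folklore] -/
theorem smul_momentumBox_one {L : ℝ} (hL : 0 < L) : L • momentumBox d 1 = momentumBox d L := by
  ext u
  rw [Set.mem_smul_set_iff_inv_smul_mem₀ hL.ne', momentumBox, momentumBox, Set.mem_univ_pi, Set.mem_univ_pi]
  refine forall_congr' fun i => ?_
  simp only [Pi.smul_apply, smul_eq_mul, Set.mem_Ioc, mul_one]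
  rw [inv_mul_eq_div, lt_div_iff₀ hL, div_le_iff₀ hL]
  constructor <;> rintro ⟨h1, h2⟩ <;> constructor <;> nlinarith

/-- Points of `(-π,π]^d` lie in the cube `‖k‖_∞ ≤ π`. [folklore] -/
theorem norm_le_pi_of_mem_momentumBox_one {k : Fin d → ℝ} (hk : k ∈ momentumBox d 1) : ‖k‖ ≤ Real.pi := by
  refine (pi_norm_le_iff_of_nonneg Real.pi_pos.le).2 fun i => ?_
  have h := hk i (Set.mem_univ i)
  rw [Set.mem_Ioc, mul_one] at h
  rw [Real.norm_eq_abs, abs_le]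
  exact ⟨h.1.le, h.2⟩

/-- `‖k‖^{-2}` is integrable on `(-π,π]^d` for `d ≥ 3`. [folklore] -/
theorem integrableOn_norm_rpow_neg_two (hd : 3 ≤ d) :
    IntegrableOn (fun k : Fin d → ℝ => ‖k‖ ^ (-(2 : ℝ))) (momentumBox d 1) := by
  have h : IntegrableOn (fun k : Fin d → ℝ => ‖k‖ ^ (-(2 : ℝ))) (Metric.ball 0 (Real.pi + 1)) := by
    refine integrableOn_ball_of_norm_le_rpow (μ := volume) (C := 1) (α := 2) (r := Real.pi + 1) ?_ ?_
      (ae_of_all _ fun k => by rw [Real.norm_eq_abs, abs_of_nonneg (Real.rpow_nonneg (norm_nonneg _) _), one_mul])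
      (measurable_norm.pow_const _).aestronglyMeasurable
    · rw [Module.finrank_fin_fun]; omega
    · rw [Module.finrank_fin_fun]; exact_mod_cast (by omega : 2 < d)
  refine h.mono_set fun k hk => ?_
  rw [Metric.mem_ball, dist_zero_right]
  linarith [norm_le_pi_of_mem_momentumBox_one hk]

variable {C₀ α : ℝ}

/-- **The infrared majorant is integrable on the Brillouin zone** (`d ≥ 3`): with the nearest-neighbour
cube bound `1 - Ĵ(k) ≥ c₁‖k‖²`, `1/(1 - Ĵ(k)) ≤ ‖k‖^{-2}/c₁ ∈ L¹((-π,π]^d)`.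
[cite: Panis2023Triviality, §3.3 ("using that (1-Ĵ(p)) ≳ |p|² near 0, we see that if d ≥ 3 …")] -/
theorem integrableOn_inv_gap (hd : 3 ≤ d) (hC₀ : 0 < C₀) (hα : 0 < α) :
    IntegrableOn (fun k : Fin d → ℝ => 1 / (1 - couplingFourier (algebraicCoupling d C₀ α) k))
      (momentumBox d 1) := by
  have hd1 : 1 ≤ d := by omega
  set J := algebraicCoupling d C₀ α with hJdef
  have hpos := couplingNorm_algebraic_pos hd1 hC₀ hα
  have hs := algebraicCoupling_zero_summable hd1 hC₀.le hα
  have hJ0 : ∀ y, 0 ≤ J 0 y := fun y => algebraicCoupling_nonneg hC₀.le α 0 y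
  obtain ⟨c₁, hc₁, hnn⟩ := sq_le_one_sub_couplingFourier_algebraic hd1 hC₀ hα
  refine Integrable.mono' ((integrableOn_norm_rpow_neg_two hd).const_mul (1 / c₁)) ?_ ?_
  · exact (measurable_const.div (measurable_const.sub (continuous_couplingFourier J hJ0 hs).measurable)).aestronglyMeasurable
  · refine (ae_restrict_iff' (measurableSet_momentumBox 1)).2 (ae_of_all _ fun k hk => ?_)
    have hD := one_sub_couplingFourier_nonneg J hJ0 hs hpos k
    rw [Real.norm_eq_abs, abs_of_nonneg (div_nonneg zero_le_one hD)]
    by_cases hk0 : k = 0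
    · subst hk0
      rw [couplingFourier_zero J hpos.ne', sub_self, div_zero]
      exact mul_nonneg (by positivity) (Real.rpow_nonneg (norm_nonneg _) _)
    · have hkπ := norm_le_pi_of_mem_momentumBox_one hk
      have hq0 : 0 < ‖k‖ := norm_pos_iff.2 hk0
      have h1 := hnn k hkπ
      have h2 : 0 < c₁ * ‖k‖ ^ 2 := by positivity
      calc 1 / (1 - couplingFourier J k) ≤ 1 / (c₁ * ‖k‖ ^ 2) := div_le_div_of_nonneg_left zero_le_one h2 h1
        _ = 1 / c₁ * ‖k‖ ^ (-(2 : ℝ)) := by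
            rw [Real.rpow_neg (norm_nonneg _), Real.rpow_two]; field_simp

/-- **Gaussian domination of the Fejér-weighted double sum** (`0 < β < β_c`, `L ≥ 1`, `d ≥ 3`): from
Parseval, Proposition 3.7 and the Fejér envelope,
`∑_{x,y∈Λ_L} S_β(x-y) ≤ (9π²)^d/(2(2π)^d) · L^d/(β|J|) ∫_{(-πL,πL]^d} W(u)/(1 - Ĵ(u/L)) du`.
[cite: Panis2023Triviality, proof of Proposition 3.8 (χ̃_L ≤ C₃L^d∫e^{-L²‖p‖²}Ŝ(p)dp, "with the change of variable u = pL, and Proposition 3.7")] -/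
theorem sum_sum_pairCorrelation_le (h37 : panis_prop37_infraredBound) (habf : abf_pairCorrelation_summable)
    (hd : 3 ≤ d) (hC₀ : 0 < C₀) (hα : 0 < α) {β : ℝ} (hβ : 0 < β)
    (hβc : β < LongRangeIsing.criticalBeta (algebraicCoupling d C₀ α)) {L : ℕ} (hL : 1 ≤ L) :
    ∑ x ∈ box d L, ∑ y ∈ box d L, pairCorrelation (algebraicCoupling d C₀ α) β 0 (x - y) ≤
      (9 * Real.pi ^ 2) ^ d / (2 * (2 * Real.pi) ^ d) * ((L : ℝ) ^ d / (β * couplingNorm (algebraicCoupling d C₀ α))) *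
        ∫ u in momentumBox d L, envelope d u / (1 - couplingFourier (algebraicCoupling d C₀ α) (fun i => u i / L)) := by
  have hd1 : 1 ≤ d := by omega
  set J := algebraicCoupling d C₀ α with hJdef
  have hpos := couplingNorm_algebraic_pos hd1 hC₀ hα
  have hsJ := algebraicCoupling_zero_summable hd1 hC₀.le hα
  have hJ0 : ∀ y, 0 ≤ J 0 y := fun y => algebraicCoupling_nonneg hC₀.le α 0 y
  have hJnn : ∀ x y, 0 ≤ J x y := algebraicCoupling_nonneg hC₀.le α
  set S : Site d → ℝ := fun x => pairCorrelation J β 0 x with hSdef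
  have hS0 : ∀ x, 0 ≤ S x := fun x => pairCorrelation_nonneg J β hβ.le hJnn 0 x
  have hSs : Summable fun x => |S x| :=
    (habf d hd1 C₀ α hC₀ hα β hβ hβc).congr fun x => (abs_of_nonneg (hS0 x)).symm
  have hL0 : (0 : ℝ) < L := by exact_mod_cast hL
  -- Parseval
  have hpar := sum_sum_eq_integral_normSq_mul_re_siteFT hSs L
  have hre : ∀ k, (siteFT S k).re = twoPointFourier J β k := fun k =>
    re_siteFT_pairCorrelation hβ.le hJnn (habf d hd1 C₀ α hC₀ hα β hβ hβc) k
  simp_rw [hre] at hpar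
  rw [← volume_restrict_momentumCube] at hpar
  -- pass to the half-open zone `(-π,π]^d`
  have hae : (momentumBox d 1 : Set (Fin d → ℝ)) =ᵐ[volume] momentumCube d := by
    rw [MeasureTheory.volume_pi, momentumBox, momentumCube]
    have := Measure.univ_pi_Ioc_ae_eq_Icc (μ := fun _ : Fin d => (volume : Measure ℝ))
      (f := fun _ => -(Real.pi * 1)) (g := fun _ => Real.pi * 1)
    rw [← Set.pi_univ_Icc] at this
    simpa only [mul_one] using this
  rw [← setIntegral_congr_set hae] at hpar
  -- the majorant
  set B : ℝ := 2 * β * couplingNorm J with hBdef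
  have hB : 0 < B := by positivity
  set M : (Fin d → ℝ) → ℝ := fun k =>
    (9 * Real.pi ^ 2) ^ d * (L : ℝ) ^ (2 * d) * envelope d ((L : ℝ) • k) * (1 / (B * (1 - couplingFourier J k)))
    with hMdef
  have hgap0 : ∀ k, 0 ≤ 1 - couplingFourier J k := fun k => one_sub_couplingFourier_nonneg J hJ0 hsJ hpos k
  -- integrability of the majorant on the zone
  have hIg := integrableOn_inv_gap hd hC₀ hα
  have hMint : IntegrableOn M (momentumBox d 1) := by
    have h1 : IntegrableOn (fun k => (9 * Real.pi ^ 2) ^ d * (L : ℝ) ^ (2 * d) * (1 / B) *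
        (1 / (1 - couplingFourier J k))) (momentumBox d 1) := hIg.const_mul _
    refine Integrable.mono' h1 ?_ ?_
    · refine ((continuous_const.mul (continuous_envelope.comp (continuous_const_smul (L : ℝ)))).measurable.mul
        (measurable_const.div (measurable_const.mul (measurable_const.sub
          (continuous_couplingFourier J hJ0 hsJ).measurable)))).aestronglyMeasurable
    · refine ae_of_all _ fun k => ?_
      have hE0 := envelope_nonneg ((L : ℝ) • k)
      have hE1 := envelope_le_one ((L : ℝ) • k)
      have hq : 0 ≤ 1 / (B * (1 - couplingFourier J k)) := div_nonneg zero_le_one (mul_nonneg hB.le (hgap0 k))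
      rw [Real.norm_eq_abs, hMdef, abs_of_nonneg (mul_nonneg (by positivity) hq)]
      have : 1 / (B * (1 - couplingFourier J k)) = 1 / B * (1 / (1 - couplingFourier J k)) := by
        rw [one_div_mul_one_div]
      rw [this]
      have hq' : 0 ≤ 1 / (1 - couplingFourier J k) := div_nonneg zero_le_one (hgap0 k)
      calc (9 * Real.pi ^ 2) ^ d * (L : ℝ) ^ (2 * d) * envelope d ((L : ℝ) • k) * (1 / B * (1 / (1 - couplingFourier J k)))
          ≤ (9 * Real.pi ^ 2) ^ d * (L : ℝ) ^ (2 * d) * 1 * (1 / B * (1 / (1 - couplingFourier J k))) := by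
            gcongr
        _ = _ := by ring
  -- integrability of the left integrand (bounded and continuous)
  have hSc : Continuous fun k => twoPointFourier J β k := by
    have := (continuous_siteFT hSs)
    have h2 : Continuous fun k => (siteFT S k).re := Complex.continuous_re.comp this
    simpa only [hre] using h2
  haveI : IsFiniteMeasure ((volume : Measure (Fin d → ℝ)).restrict (momentumBox d 1)) := by
    refine isFiniteMeasure_restrict.2 (ne_of_lt (Bornology.IsBounded.measure_lt_top ?_))
    refine (Metric.isBounded_closedBall (x := (0 : Fin d → ℝ)) (r := Real.pi)).subset fun k hk => ?_
    rw [Metric.mem_closedBall, dist_zero_right]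
    exact norm_le_pi_of_mem_momentumBox_one hk
  have hFint : IntegrableOn (fun k => ‖boxCharSum d L k‖ ^ 2 * twoPointFourier J β k) (momentumBox d 1) := by
    refine Integrable.mono' (integrable_const ((#(box d L) : ℝ) ^ 2 * ∑' x, |S x|)) ?_ (ae_of_all _ fun k => ?_)
    · exact (((continuous_boxCharSum L).norm.pow 2).mul hSc).aestronglyMeasurable
    · rw [Real.norm_eq_abs, abs_mul, abs_of_nonneg (sq_nonneg _)]
      refine mul_le_mul (pow_le_pow_left₀ (norm_nonneg _) (norm_boxCharSum_le L k) 2) ?_ (abs_nonneg _) (sq_nonneg _)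
      rw [← hre, ← Real.norm_eq_abs]
      exact (Complex.abs_re_le_norm _).trans (norm_siteFT_le hSs k)
  -- the pointwise (a.e.) bound
  have hd0 : 0 < d := by omega
  have hae2 : ∀ᵐ k ∂(volume.restrict (momentumBox d 1)), ‖boxCharSum d L k‖ ^ 2 * twoPointFourier J β k ≤ M k := by
    have hnull : ∀ᵐ k : Fin d → ℝ ∂volume, k (⟨0, hd0⟩ : Fin d) ≠ (0 : ℝ) := by
      rw [MeasureTheory.volume_pi]
      exact Measure.ae_eval_ne (fun _ => (volume : Measure ℝ)) (⟨0, hd0⟩ : Fin d) 0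
    refine (ae_restrict_iff' (measurableSet_momentumBox 1)).2 ?_
    filter_upwards [hnull] with k hk0 hk
    have hkne : k ≠ 0 := fun h => hk0 (by rw [h]; rfl)
    have hkπ := norm_le_pi_of_mem_momentumBox_one hk
    have h1 := h37 d hd1 C₀ α hC₀ hα β hβ hβc k hk hkne
    have hq : 0 ≤ 1 / (B * (1 - couplingFourier J k)) := div_nonneg zero_le_one (mul_nonneg hB.le (hgap0 k))
    calc ‖boxCharSum d L k‖ ^ 2 * twoPointFourier J β k
        ≤ ‖boxCharSum d L k‖ ^ 2 * (1 / (B * (1 - couplingFourier J k))) :=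
          mul_le_mul_of_nonneg_left h1 (sq_nonneg _)
      _ ≤ (9 * Real.pi ^ 2) ^ d * (L : ℝ) ^ (2 * d) * envelope d ((L : ℝ) • k) * (1 / (B * (1 - couplingFourier J k))) :=
          mul_le_mul_of_nonneg_right (norm_sum_box_cexp_sq_le hL hkπ) hq
  have hstep1 : ∫ k in momentumBox d 1, ‖boxCharSum d L k‖ ^ 2 * twoPointFourier J β k ≤ ∫ k in momentumBox d 1, M k :=
    integral_mono_ae hFint hMint hae2
  -- the substitution `u = Lk`
  set g : (Fin d → ℝ) → ℝ := fun u => envelope d u / (1 - couplingFourier J (fun i => u i / L)) with hgdef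
  have hgL : ∀ k, g ((L : ℝ) • k) = envelope d ((L : ℝ) • k) / (1 - couplingFourier J k) := by
    intro k
    simp only [hgdef, Pi.smul_apply, smul_eq_mul]
    congr 3
    funext i
    field_simp
  have hsubst : ∫ k in momentumBox d 1, g ((L : ℝ) • k) = ((L : ℝ) ^ d)⁻¹ * ∫ u in momentumBox d L, g u := by
    have := Measure.setIntegral_comp_smul_of_pos (μ := (volume : Measure (Fin d → ℝ))) g (momentumBox d 1) hL0
    rw [smul_momentumBox_one hL0, Module.finrank_fin_fun, smul_eq_mul] at this
    exact this
  have hM_eq : ∀ k, M k = (9 * Real.pi ^ 2) ^ d * (L : ℝ) ^ (2 * d) / B * g ((L : ℝ) • k) := by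
    intro k
    rw [hgL, hMdef]
    simp only
    rw [one_div, mul_inv]
    ring
  have hstep2 : ∫ k in momentumBox d 1, M k =
      (9 * Real.pi ^ 2) ^ d * (L : ℝ) ^ (2 * d) / B * (((L : ℝ) ^ d)⁻¹ * ∫ u in momentumBox d L, g u) := by
    simp_rw [hM_eq]
    rw [integral_const_mul, hsubst]
  -- assemble
  have hπd : (0 : ℝ) < (2 * Real.pi) ^ d := by positivity
  have key : (2 * Real.pi) ^ d * ∑ x ∈ box d L, ∑ y ∈ box d L, S (x - y) ≤
      (9 * Real.pi ^ 2) ^ d * (L : ℝ) ^ (2 * d) / B * (((L : ℝ) ^ d)⁻¹ * ∫ u in momentumBox d L, g u) := by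
    rw [hpar, ← hstep2]; exact hstep1
  have key' := (le_div_iff₀' hπd).2 key
  refine key'.trans (le_of_eq ?_)
  rw [hBdef]
  field_simp
  ring

end DoubleSum

end LongRangeIsing

/-! ### The Messager–Miracle-Solé averaging and the two lattice counts -/

namespace LongRangeIsing

variable {d : ℕ}

section Averaging

variable (J : Site d → Site d → ℝ) (β : ℝ)

/-- **`|Λ_m| χ_m ≤ ∑_{x,y∈Λ_L} S(x-y)` for `2m ≤ L`** (`S ≥ 0`: keep `x ∈ Λ_m` and `y = x - z`,
`z ∈ Λ_m`). [folklore] -/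
theorem card_box_mul_boxSusceptibility_le_sum_sum (hβ : 0 ≤ β) (hJ : ∀ x y, 0 ≤ J x y) {m L : ℕ}
    (hmL : 2 * m ≤ L) :
    (#(box d m) : ℝ) * boxSusceptibility J β m ≤
      ∑ x ∈ box d L, ∑ y ∈ box d L, pairCorrelation J β 0 (x - y) := by
  have hS0 : ∀ z, 0 ≤ pairCorrelation J β 0 z := fun z => pairCorrelation_nonneg J β hβ hJ 0 z
  have hmL' : m ≤ L := by omega
  calc (#(box d m) : ℝ) * boxSusceptibility J β m
      = ∑ x ∈ box d m, ∑ z ∈ box d m, pairCorrelation J β 0 z := by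
        rw [Finset.sum_const, nsmul_eq_mul, boxSusceptibility]
    _ ≤ ∑ x ∈ box d m, ∑ y ∈ box d L, pairCorrelation J β 0 (x - y) := by
        refine Finset.sum_le_sum fun x hx => ?_
        have hinj : Set.InjOn (fun z : Site d => x - z) (box d m) := fun z _ z' _ h => sub_right_injective h
        calc ∑ z ∈ box d m, pairCorrelation J β 0 z
            = ∑ y ∈ (box d m).image (fun z => x - z), pairCorrelation J β 0 (x - y) := by
              rw [Finset.sum_image hinj]
              exact Finset.sum_congr rfl fun z _ => by rw [sub_sub_cancel]
          _ ≤ ∑ y ∈ box d L, pairCorrelation J β 0 (x - y) := by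
              refine Finset.sum_le_sum_of_subset_of_nonneg (fun y hy => ?_) fun y _ _ => hS0 _
              obtain ⟨z, hz, rfl⟩ := Finset.mem_image.1 hy
              rw [mem_box] at hx hz ⊢
              intro i
              have h1 := hx i; have h2 := hz i
              simp only [Pi.sub_apply]
              constructor <;> omega
    _ ≤ ∑ x ∈ box d L, ∑ y ∈ box d L, pairCorrelation J β 0 (x - y) :=
        Finset.sum_le_sum_of_subset_of_nonneg (box_mono d hmL') fun x _ _ =>
          Finset.sum_nonneg fun y _ => hS0 _

end Averaging

/-- `n ≤ 2⌊n/2⌋ + 1`, so `n^d ≤ |Λ_{⌊n/2⌋}|`. [folklore] -/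
private theorem pow_le_card_box_half (n : ℕ) : (n : ℝ) ^ d ≤ #(box d (n / 2)) := by
  rw [card_box]
  push_cast
  exact pow_le_pow_left₀ (Nat.cast_nonneg n) (by norm_cast; omega) d

/-- `n/d ≤ 2⌊n/d⌋ + 1` (`d ≥ 1`), so `(n/d)^d ≤ |Λ_{⌊n/d⌋}|`. [folklore] -/
theorem div_pow_le_card_box_div (hd : 1 ≤ d) (n : ℕ) : ((n : ℝ) / d) ^ d ≤ #(box d (n / d)) := by
  rw [card_box]
  push_cast
  refine pow_le_pow_left₀ (by positivity) ?_ d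
  have hd0 : (0 : ℝ) < d := by exact_mod_cast hd
  rw [div_le_iff₀ hd0]
  have h1 : n < d * (n / d + 1) := by
    have := Nat.lt_div_mul_add (a := n) hd
    nlinarith [Nat.div_add_mod n d, Nat.mod_lt n hd]
  have h2 : (n : ℝ) ≤ d * (n / d + 1 : ℕ) := by exact_mod_cast h1.le
  push_cast at h2
  nlinarith [show (0 : ℝ) ≤ ((n / d : ℕ) : ℝ) from Nat.cast_nonneg _]

end LongRangeIsing

/-! ### Proposition 3.8's first display (kernel form) from Proposition 3.7 -/

/-- **`panis_prop38_kernelForm` from Proposition 3.7, the ABF summability and MMS2** — the printed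
proof of Proposition 3.8 with the Fejér kernel in place of the Gaussian weight: for `x ≠ 0`,
`n = |x|_∞`, MMS2 averaged over `Λ_{⌊n/d⌋}` gives `S(x) ≤ χ_{⌊n/d⌋}/|Λ_{⌊n/d⌋}| ≤ χ_{⌊n/2⌋}/|Λ_{⌊n/d⌋}|`;
`|Λ_{⌊n/2⌋}|χ_{⌊n/2⌋} ≤ ∑_{Λ_n×Λ_n}S(x-y) ≤ K_d n^d/(β|J|)∫_{(-πn,πn]^d}W(u)/(1-Ĵ(u/n))du`
(`sum_sum_pairCorrelation_le`), and `|Λ_{⌊n/2⌋}| ≥ n^d`, `|Λ_{⌊n/d⌋}| ≥ (n/d)^d`; the case `β = β_c`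
follows by the left-continuity of the free state in `β` (`tendsto_pairCorrelation_nhdsLT`).
[cite: Panis2023Triviality, proof of Proposition 3.8] -/
theorem panis_prop38_kernelForm_of_prop37 (h37 : panis_prop37_infraredBound)
    (habf : abf_pairCorrelation_summable) (hM : panis_mms_two_point_monotone) : panis_prop38_kernelForm := by
  intro d hd C₀ α hC₀ hα
  have hd1 : 1 ≤ d := by omega
  set J := algebraicCoupling d C₀ α with hJdef
  have hpos := couplingNorm_algebraic_pos hd1 hC₀ hα
  have hJnn : ∀ x y, 0 ≤ J x y := algebraicCoupling_nonneg hC₀.le α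
  set K : ℝ := (9 * Real.pi ^ 2) ^ d / (2 * (2 * Real.pi) ^ d) with hKdef
  have hK : 0 < K := by positivity
  set C : ℝ := K * (d : ℝ) ^ d / couplingNorm J with hCdef
  have hC : 0 < C := by positivity
  refine ⟨C, hC, fun β hβ hββc x hx => ?_⟩
  set n : ℕ := Site.supNorm x with hndef
  have hxn : ‖x‖ = n := Site.norm_eq_supNorm x
  have hn1 : 1 ≤ n := Nat.one_le_iff_ne_zero.2 fun h => hx (Site.supNorm_eq_zero_iff.1 h)
  have hn0 : (0 : ℝ) < n := by exact_mod_cast hn1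
  set I : ℝ := ∫ u in momentumBox d n, envelope d u / (1 - couplingFourier J (fun i => u i / n)) with hIdef
  rw [hxn]
  -- the bound below `β_c`
  have hsub : ∀ β', 0 < β' → β' < LongRangeIsing.criticalBeta J →
      pairCorrelation J β' 0 x ≤ C / (β' * (n : ℝ) ^ d) * I := by
    intro β' hβ' hβ'c
    have hmms : ∀ a b : Site d, (d : ℝ) * ‖a‖ ≤ ‖b‖ → pairCorrelation J β' 0 b ≤ pairCorrelation J β' 0 a :=
      hM d hd1 C₀ α hC₀ hα β' hβ'
    -- MMS averaging over `Λ_{⌊n/d⌋}`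
    have h1 : (#(box d (n / d)) : ℝ) * pairCorrelation J β' 0 x ≤ boxSusceptibility J β' (n / d) :=
      card_box_mul_pairCorrelation_le_boxSusceptibility J β' hmms (by rw [hndef]; exact Nat.mul_div_le _ d)
    -- monotonicity `χ_{⌊n/d⌋} ≤ χ_{⌊n/2⌋}`
    have h2 : boxSusceptibility J β' (n / d) ≤ boxSusceptibility J β' (n / 2) :=
      boxSusceptibility_mono J β' hβ'.le hJnn (Nat.div_le_div_left (by omega) two_pos)
    -- the double sum
    have h3 : (#(box d (n / 2)) : ℝ) * boxSusceptibility J β' (n / 2) ≤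
        ∑ a ∈ box d n, ∑ b ∈ box d n, pairCorrelation J β' 0 (a - b) :=
      card_box_mul_boxSusceptibility_le_sum_sum J β' hβ'.le hJnn (Nat.mul_div_le n 2 |> fun h => by omega)
    have h4 := sum_sum_pairCorrelation_le (d := d) h37 habf hd hC₀ hα hβ' hβ'c hn1
    -- cardinalities
    have hc1 : ((n : ℝ)) ^ d ≤ #(box d (n / 2)) := pow_le_card_box_half n
    have hc2 : ((n : ℝ) / d) ^ d ≤ #(box d (n / d)) := div_pow_le_card_box_div hd1 n
    have hcpos1 : (0 : ℝ) < #(box d (n / 2)) := lt_of_lt_of_le (by positivity) hc1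
    have hcpos2 : (0 : ℝ) < #(box d (n / d)) := lt_of_lt_of_le (by positivity) hc2
    -- combine: `|Λ_{n/d}| |Λ_{n/2}| S(x) ≤ K n^d/(β|J|) I`
    have h6 : (#(box d (n / 2)) : ℝ) * ((#(box d (n / d)) : ℝ) * pairCorrelation J β' 0 x) ≤
        K * ((n : ℝ) ^ d / (β' * couplingNorm J)) * I :=
      (mul_le_mul_of_nonneg_left (h1.trans h2) hcpos1.le).trans (h3.trans h4)
    have h7 : (n : ℝ) ^ d * (((n : ℝ) / d) ^ d * pairCorrelation J β' 0 x) ≤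
        K * ((n : ℝ) ^ d / (β' * couplingNorm J)) * I := by
      refine le_trans ?_ h6
      have hS := pairCorrelation_nonneg J β' hβ'.le hJnn 0 x
      exact mul_le_mul hc1 (mul_le_mul_of_nonneg_right hc2 hS) (by positivity) hcpos1.le
    -- solve for `S(x)`
    have hd0 : (0 : ℝ) < d := by exact_mod_cast hd1
    have hnd : (0 : ℝ) < (n : ℝ) ^ d * ((n : ℝ) / d) ^ d := by positivity
    rw [← mul_assoc] at h7
    have h8 : pairCorrelation J β' 0 x ≤ K * ((n : ℝ) ^ d / (β' * couplingNorm J)) * I / ((n : ℝ) ^ d * ((n : ℝ) / d) ^ d) :=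
      (le_div_iff₀' hnd).2 h7
    refine h8.trans (le_of_eq ?_)
    rw [hCdef, div_pow]
    field_simp
  -- `β < β_c` or `β = β_c` (left-continuity)
  rcases hββc.lt_or_eq with hlt | heq
  · exact hsub β hβ hlt
  · have hβc : 0 < LongRangeIsing.criticalBeta J := hβ.trans_le hββc
    rw [heq]
    have hlim := tendsto_pairCorrelation_nhdsLT J hJnn hβc (0 : Site d) x
    have hR : Tendsto (fun β' : ℝ => C / (β' * (n : ℝ) ^ d) * I) (𝓝[<] LongRangeIsing.criticalBeta J)
        (𝓝 (C / (LongRangeIsing.criticalBeta J * (n : ℝ) ^ d) * I)) := by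
      refine (ContinuousAt.tendsto ?_).mono_left nhdsWithin_le_nhds
      refine ((continuousAt_const.div (continuousAt_id.mul continuousAt_const) ?_).mul continuousAt_const)
      exact mul_ne_zero hβc.ne' (pow_ne_zero _ hn0.ne')
    refine le_of_tendsto_of_tendsto hlim hR ?_
    filter_upwards [Ioo_mem_nhdsLT hβc] with β' hβ'
    exact hsub β' hβ'.1 hβ'.2

/-- **The vendored fact `panis_infraredBound_algebraic` from Proposition 3.7, the ABF summability and
MMS2.** [cite: Panis2023Triviality, §3.6 (last display) with Propositions 3.7, 3.8 and Corollary 3.3] -/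
theorem panis_infraredBound_algebraic_of_prop37 (h37 : panis_prop37_infraredBound)
    (habf : abf_pairCorrelation_summable) (hM : panis_mms_two_point_monotone) :
    panis_infraredBound_algebraic :=
  panis_infraredBound_algebraic_of_kernelForm (panis_prop38_kernelForm_of_prop37 h37 habf hM)

/-- **`panis_prop38_kernelForm` from Proposition 3.7 and the ABF summability**, MMS2 being the tree's
theorem `panis_mms_two_point_monotone_holds`. [cite: Panis2023Triviality, proof of Proposition 3.8] -/
theorem panis_prop38_kernelForm_of_prop37' (h37 : panis_prop37_infraredBound)
    (habf : abf_pairCorrelation_summable) : panis_prop38_kernelForm :=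
  panis_prop38_kernelForm_of_prop37 h37 habf panis_mms_two_point_monotone_holds

/-- **HEADLINE — the vendored fact `panis_infraredBound_algebraic` (Panis 2023, §3.6) from Proposition 3.7
and the ABF finiteness of the susceptibility below `β_c`.** [cite: Panis2023Triviality, §3.6 (last display) with Propositions 3.7, 3.8 and Corollary 3.3] -/
theorem panis_infraredBound_algebraic_of_prop37' (h37 : panis_prop37_infraredBound)
    (habf : abf_pairCorrelation_summable) : panis_infraredBound_algebraic :=
  panis_infraredBound_algebraic_of_prop37 h37 habf panis_mms_two_point_monotone_holds

end Literature.Barriers.CriticalPhenomena
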